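import Summits.HodgeConjecture.CorCM.Census.QuarticTwistClosing

/-!
# The quartic twist `(ℤ/4 × B, (2,0))`, VII: THE GENERATION THEOREM — a covering family of squares plus the column face at a constant type,
# the column face at a Boolean half-type and the equatorial square generate the Hodge lattice modulo pairs (`|B|` odd)

COR-CM (cell `pub-hodgecm2`), count-neutral kernel combinatorics by the binder seat b09 (gen 32; lane QUARTIC-TWIST), part VII, sequel of
`Census/QuarticTwistClosing.lean`.  Theorems only; no `decide` table, no certificate, no named fact, no geometry, no `sorry`.
HONEST FRAMING: `HC_CM` is NOT proved, here or anywhere in the tree; nothing here is a headline and nothing here produces a period.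

**MAIN THEOREM (`hodge_le_of_family`).**  Let `B` be a finite group of odd order `2m + 1 ≥ 3` (additive notation; commutativity is
never used), `G = ℤ/4 × B`, `c = (2, 0)`.  Let `S` be a finite family of rank-four faces `(s; p, q)` (`p ≠ q`) such that
(i) `P ⊔ ℤ[G]·S` COVERS (through every non-residual clock type some translate of a member is a cross square with `Φ`-smaller corners —
part III), (ii) `S` contains a column face at a constant type, and (iii) for some `Q ⊆ B` with `|Q| = m` and `i ≠ j` outside `Q`,
`S` contains the column face at the Boolean half-type `𝟙_Q` in the column `i` and the equatorial square `(𝟙_Q; (0,i), (0,j))`.  Then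
  `hodge B ≤ pairs B ⊔ spanFaces B S`:
the Hodge lattice of the whole slice of the quartic twist is generated, modulo divisor classes and INTEGRALLY, by the Galois translates
of the classes of the faces of `S`.  PROOF: part III reduces every Hodge vector modulo `P ⊔ ℤ[G]·S` to one supported on the small
residual types; part VI computes the reductions of the two closing faces — a Boolean pair difference `X_{1,i}` (up to two pairs) and
`Σ_{q∈Q} X_{0,q} − w_1`; their translates give all `X_{u,b}`, `w_u` (§1); part IV then absorbs the residual vector.
Part VIII (`Census/QuarticTwistCount.lean`) exhibits such a family with `|S| + 1 = β(ℤ/4 × B)` (one square per non-residual block, three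
closing faces, four residual blocks), so that with the coinvariant floor `μ(ℤ/4 × B) = β − 1 = φ₂` for every finite group `B` of odd order.
All [folklore].

## References
* [Pohlmann1968] H. Pohlmann, Algebraic cycles on abelian varieties of complex multiplication type, Ann. of Math. 88 (1968), Thm 1.
* [Milne1999] J. S. Milne, Lefschetz motives and the Tate conjecture, Compositio Math. 117 (1999), Prop. 2.1, p. 54.
-/

namespace Summit.HodgeConjecture.CorCM.Census.QuarticTwist

open Finset

variable (B : Type) [AddGroup B] [Fintype B] [DecidableEq B]

/-! ## §1 Symmetry of face classes; translates of `X`, `w` and of the column faces -/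

omit [AddGroup B] in
/-- **Face classes are symmetric in the two places.** [folklore] -/
theorem faceVec_comm (s : Ty B) (p q : ZMod 2 × B) : faceVec B s p q = faceVec B s q p := by
  have hflip : flip B q (flip B p s) = flip B p (flip B q s) := by
    obtain ⟨j, b⟩ := p
    obtain ⟨j', b'⟩ := q
    by_cases hcol : b = b'
    · subst hcol
      by_cases hjj : j' = j
      · rw [hjj]
      · have hq1 : j' = j + 1 := by
          have key : ∀ j j' : ZMod 2, j' ≠ j → j' = j + 1 := by decide
          exact key _ _ hjj
        subst hq1
        have h1 := flip_flip_same B j b s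
        have h2 := flip_flip_same B (j + 1) b s
        have key : ∀ j : ZMod 2, j + 1 + 1 = j := by decide
        rw [key] at h2
        rw [h1, h2]
    · exact flip_comm B (j, b) (j', b') hcol s
  unfold faceVec
  rw [hflip]
  abel

omit [Fintype B] [DecidableEq B] in
/-- Group bookkeeping: `b₀ − (−b + b₀) = b`. [folklore] -/
theorem sub_neg_add_self (b b₀ : B) : b₀ - (-b + b₀) = b := by
  rw [sub_eq_add_neg, neg_add_rev, neg_neg, ← add_assoc, add_neg_cancel, zero_add]

omit [Fintype B] [DecidableEq B] in
/-- Translation commutes with finite sums. [folklore] -/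
theorem transl_sum {ι : Type} (g : ZMod 4 × B) (T : Finset ι) (f : ι → Ty B → ℤ) :
    transl B g (∑ x ∈ T, f x) = ∑ x ∈ T, transl B g (f x) := by
  have h := map_sum (translHom B g) f T
  simpa only [translHom_apply] using h

/-- **Translates of the Boolean pair differences**: `(v,t)·X_{u,b} = X_{u+v, b−t}`. [folklore] -/
theorem transl_Xvec (g : ZMod 4 × B) (u : ZMod 4) (b : B) : transl B g (Xvec B u b) = Xvec B (u + g.1) (b - g.2) := by
  unfold Xvec
  rw [transl_sub, transl_sub, transl_add, transl_single, transl_single, transl_single, transl_single, tw_atom, tw_atom, tw_cst, tw_cst,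
    add_right_comm u 1 g.1]

/-- **Translates of the Weil vectors**: `(v,0)·w_u = w_{u+v}`. [folklore] -/
theorem transl_Wvec (v u : ZMod 4) : transl B (v, 0) (Wvec B u) = Wvec B (u + v) := by
  unfold Wvec
  rw [transl_sub, transl_sub, transl_smul, transl_sum, transl_single, transl_single, tw_cst, tw_cst]
  have h1 : ∑ b, transl B (v, 0) (Pi.single (atom B u b (-1)) (1 : ℤ)) = ∑ b, (Pi.single (atom B (u + v) b (-1)) (1 : ℤ) : Ty B → ℤ) := by
    refine Finset.sum_congr rfl fun b _ => ?_
    rw [transl_single, tw_atom, sub_zero]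
  rw [h1, show u - 1 + v = u + v - 1 by ring]

/-- **All Boolean pair differences from one**, by translation. [folklore] -/
theorem Xvec_mem_of_one {N : Submodule ℤ (Ty B → ℤ)} (hN : ∀ v ∈ N, ∀ g : ZMod 4 × B, transl B g v ∈ N) {i : B} (h : Xvec B 1 i ∈ N)
    (u : ZMod 4) (b : B) : Xvec B u b ∈ N := by
  have := hN _ h (u - 1, -b + i)
  rwa [transl_Xvec, sub_neg_add_self, show (1 : ZMod 4) + (u - 1) = u by ring] at this

/-- **All Weil vectors from one**, by translation. [folklore] -/
theorem Wvec_mem_of_one {N : Submodule ℤ (Ty B → ℤ)} (hN : ∀ v ∈ N, ∀ g : ZMod 4 × B, transl B g v ∈ N) (h : Wvec B 1 ∈ N) (u : ZMod 4) :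
    Wvec B u ∈ N := by
  have := hN _ h (u - 1, 0)
  rwa [transl_Wvec, show (1 : ZMod 4) + (u - 1) = u by ring] at this

/-- **All column faces at constant types from one member of the family**, by translation (and the symmetry of face classes when the
parity of the rotation swaps the two places of the column). [folklore] -/
theorem hasColumnFaces_of_mem {S : Finset (Ty B × (ZMod 2 × B) × (ZMod 2 × B))} {b₀ : B}
    (hmem : (cst B 0, ((0 : ZMod 2), b₀), ((1 : ZMod 2), b₀)) ∈ S) : HasColumnFaces B (pairs B ⊔ spanFaces B S) := by
  intro u b
  have h := transl_faceVec_mem_spanFaces B hmem (u, -b + b₀)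
  rw [transl_faceVec, tw_cst, zero_add] at h
  simp only [plc, sub_neg_add_self, zero_add] at h
  have key : ∀ u : ZMod 4, par u = 0 ∨ par u = 1 := by decide
  rcases key u with hp | hp
  · rw [hp, add_zero] at h
    exact Submodule.mem_sup_right h
  · rw [hp, show (1 : ZMod 2) + 1 = 0 by decide, faceVec_comm] at h
    exact Submodule.mem_sup_right h

/-! ## §2 The generation theorem -/

/-- **THE GENERATION THEOREM for the quartic twist, family form** (`|B| = 2m + 1`, `m ≥ 1`).  A family of faces which covers, contains a
column face at a constant type, the column face at a Boolean half-type `𝟙_Q` (`|Q| = m`) in a column `i ∉ Q`, and the equatorial square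
`(𝟙_Q; (0,i), (0,j))` (`j ∉ Q`, `j ≠ i`) generates the Hodge lattice modulo pairs, integrally:
`hodge B ≤ pairs B ⊔ spanFaces B S`. [folklore] -/
theorem hodge_le_of_family (hB : Odd (Fintype.card B)) {m : ℕ} (hm : Fintype.card B = 2 * m + 1) (h1 : 1 ≤ m)
    {S : Finset (Ty B × (ZMod 2 × B) × (ZMod 2 × B))} (hS : ∀ f ∈ S, f.2.1 ≠ f.2.2) (hcov : Covers B (pairs B ⊔ spanFaces B S))
    {b₀ : B} (hcol : (cst B 0, ((0 : ZMod 2), b₀), ((1 : ZMod 2), b₀)) ∈ S)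
    {Q : Finset B} (hQ : Q.card = m) {i j : B} (hi : i ∉ Q) (hj : j ∉ Q) (hji : j ≠ i)
    (hF2 : (prof B Q i 0, ((0 : ZMod 2), i), ((1 : ZMod 2), i)) ∈ S) (hF3 : (prof B Q i 0, ((0 : ZMod 2), i), ((0 : ZMod 2), j)) ∈ S) :
    hodge B ≤ pairs B ⊔ spanFaces B S := by
  have h3 : 3 ≤ Fintype.card B := by omega
  have hNH : pairs B ⊔ spanFaces B S ≤ hodge B := sup_le (pairs_le_hodge B) (spanFaces_le_hodge B hS)
  have hNt : ∀ v ∈ pairs B ⊔ spanFaces B S, ∀ g : ZMod 4 × B, transl B g v ∈ pairs B ⊔ spanFaces B S :=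
    fun v hv g => transl_mem_sup B hv g
  have hC : HasColumnFaces B (pairs B ⊔ spanFaces B S) := hasColumnFaces_of_mem B hcol
  have hP : pairs B ≤ pairs B ⊔ spanFaces B S := le_sup_left
  obtain ⟨N, hN⟩ : ∃ N : Submodule ℤ (Ty B → ℤ), pairs B ⊔ spanFaces B S = N := ⟨_, rfl⟩
  rw [hN] at hNH hNt hC hP hcov ⊢
  -- the corner types and their regimes
  obtain ⟨c1, c2, c12, cj, cij⟩ := corners B Q hi hj hji
  obtain ⟨r0, r1, rm1, r2, rj0, rj1⟩ := reg_corners B hB hm h1 Q hQ hi hj hji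
  have red : ∀ s : Ty B, Pi.single s 1 - affine B (reg B s) s ∈ N := fun s => single_sub_affine_mem B hB h3 hcov s
  have eT1 := red (prof B Q i 0); rw [r0] at eT1
  have eC1 := red (prof B Q i 1); rw [r1] at eC1
  have eCm := red (prof B Q i (-1)); rw [rm1] at eCm
  have eC2 := red (prof B Q i 2); rw [r2] at eC2
  have eCj := red (prof B (insert j Q) i 0); rw [rj0] at eCj
  have eCij := red (prof B (insert j Q) i 1); rw [rj1] at eCij
  -- (1) the column face at `𝟙_Q`: `X_{1,i} ∈ N`, hence every `X_{u,b} ∈ N`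
  have hF2N : faceVec B (prof B Q i 0) (0, i) (1, i) ∈ N := by
    have h := faceVec_mem_spanFaces B hF2
    rw [← hN]
    exact Submodule.mem_sup_right h
  have hX1 : Xvec B 1 i ∈ N := by
    have hcl := closing_column B Q hi
    have e : Xvec B 1 i = faceVec B (prof B Q i 0) (0, i) (1, i)
        - (((Pi.single (prof B Q i 0) (1 : ℤ) : Ty B → ℤ) - affine B 0 (prof B Q i 0)) - ((Pi.single (prof B Q i 1) (1 : ℤ) : Ty B → ℤ) - affine B 1 (prof B Q i 1))
          - ((Pi.single (prof B Q i (-1)) (1 : ℤ) : Ty B → ℤ) - affine B 0 (prof B Q i (-1))) + ((Pi.single (prof B Q i 2) (1 : ℤ) : Ty B → ℤ) - affine B 1 (prof B Q i 2)))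
        - pairVec B (cst B 0) + pairVec B (atom B 0 i (-1)) := by
      have e' : faceVec B (prof B Q i 0) (0, i) (1, i)
          - (((Pi.single (prof B Q i 0) (1 : ℤ) : Ty B → ℤ) - affine B 0 (prof B Q i 0)) - ((Pi.single (prof B Q i 1) (1 : ℤ) : Ty B → ℤ) - affine B 1 (prof B Q i 1))
            - ((Pi.single (prof B Q i (-1)) (1 : ℤ) : Ty B → ℤ) - affine B 0 (prof B Q i (-1))) + ((Pi.single (prof B Q i 2) (1 : ℤ) : Ty B → ℤ) - affine B 1 (prof B Q i 2)))
          = affine B 0 (prof B Q i 0) - affine B 1 (prof B Q i 1) - affine B 0 (prof B Q i (-1)) + affine B 1 (prof B Q i 2) := by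
        unfold faceVec; rw [c12, c1, c2]; abel
      rw [e', hcl]; abel
    rw [e]
    refine Submodule.add_mem _ (Submodule.sub_mem _ (Submodule.sub_mem _ hF2N ?_) (hP (pairVec_mem_pairs B _))) (hP (pairVec_mem_pairs B _))
    exact Submodule.add_mem _ (Submodule.sub_mem _ (Submodule.sub_mem _ eT1 eC1) eCm) eC2
  have hX : ∀ (u : ZMod 4) (b : B), Xvec B u b ∈ N := Xvec_mem_of_one B hNt hX1
  -- (2) the equatorial square: `w_1 ∈ N`, hence every `w_u ∈ N`
  have hF3N : faceVec B (prof B Q i 0) (0, i) (0, j) ∈ N := by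
    have h := faceVec_mem_spanFaces B hF3
    rw [← hN]
    exact Submodule.mem_sup_right h
  have hW1 : Wvec B 1 ∈ N := by
    have hcl := closing_square B Q hi hj hji
    have e : Wvec B 1 = (∑ q ∈ Q, Xvec B 0 q) - (faceVec B (prof B Q i 0) (0, i) (0, j)
        - (((Pi.single (prof B Q i 0) (1 : ℤ) : Ty B → ℤ) - affine B 0 (prof B Q i 0)) - ((Pi.single (prof B Q i 1) (1 : ℤ) : Ty B → ℤ) - affine B 1 (prof B Q i 1))
          - ((Pi.single (prof B (insert j Q) i 0) (1 : ℤ) : Ty B → ℤ) - affine B 1 (prof B (insert j Q) i 0))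
          + ((Pi.single (prof B (insert j Q) i 1) (1 : ℤ) : Ty B → ℤ) - affine B 1 (prof B (insert j Q) i 1)))) := by
      have e' : faceVec B (prof B Q i 0) (0, i) (0, j)
          - (((Pi.single (prof B Q i 0) (1 : ℤ) : Ty B → ℤ) - affine B 0 (prof B Q i 0)) - ((Pi.single (prof B Q i 1) (1 : ℤ) : Ty B → ℤ) - affine B 1 (prof B Q i 1))
            - ((Pi.single (prof B (insert j Q) i 0) (1 : ℤ) : Ty B → ℤ) - affine B 1 (prof B (insert j Q) i 0))
            + ((Pi.single (prof B (insert j Q) i 1) (1 : ℤ) : Ty B → ℤ) - affine B 1 (prof B (insert j Q) i 1)))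
          = affine B 0 (prof B Q i 0) - affine B 1 (prof B Q i 1) - affine B 1 (prof B (insert j Q) i 0)
            + affine B 1 (prof B (insert j Q) i 1) := by
        unfold faceVec; rw [cij, c1, cj]; abel
      rw [e', hcl]; abel
    rw [e]
    refine Submodule.sub_mem _ (Submodule.sum_mem _ fun q _ => hX 0 q) (Submodule.sub_mem _ hF3N ?_)
    exact Submodule.add_mem _ (Submodule.sub_mem _ (Submodule.sub_mem _ eT1 eC1) eCj) eCij
  have hW : ∀ u : ZMod 4, Wvec B u ∈ N := Wvec_mem_of_one B hNt hW1
  -- (3) reduce and absorb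
  intro v hv
  obtain ⟨r, hr, hsupp⟩ := exists_reduced B hB h3 hcov hC v
  have hrH : r ∈ hodge B := by
    have e : r = v - (v - r) := by abel
    rw [e]
    exact Submodule.sub_mem _ hv (hNH hr)
  have hrN : r ∈ N := residual_mem B h3 hP hX hW hrH hsupp
  have e : v = (v - r) + r := by abel
  rw [e]
  exact Submodule.add_mem _ hr hrN

end Summit.HodgeConjecture.CorCM.Census.QuarticTwist
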